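import Mathlib
import Summits.KontsevichZagierPeriods.KontsevichZagierPeriods.Theorems.InverseLandauTateLiftingDuplicationFamily

/-!
# `TateLifting` (stmt-KontsevichZagierPeriods-9129), line `Sketch` — stub `lowdimDuplicationOneThird`:
# the instance `a = 1/3` of Legendre's duplication formula inside the Kontsevich–Zagier rules

Any two Kontsevich–Zagier integral representations `r = [(0,1), (x(1−x))^{−2/3}]` and
`r' = [(0,1), 2^{1/3} x^{−1/2} (1−x)^{−2/3}]` on `ℝ¹ = Fin 1 → ℝ` (domains `{x | x 0 ∈ Ioo 0 1}`,
integrands pinned on them) are KZ-equivalent (`tateLifting_lowdimDuplicationOneThird`; verbatim the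
open item `LowdimDuplicationOneThird`, stmt-KontsevichZagierPeriods-0118, of route LowDimension; value
identity `B(1/3,1/3) = 2^{1/3} B(1/2,1/3)`). This is the instance `a = 1/3` of the family
`InverseLandau.tateLifting_duplicationFamily` (`B(a,a) = 2^{1−2a} B(1/2,a)` inside the rules: split
`(0,1)` at `1/2`, fold by `x ↦ 1 − x`, substitute `u = (1 − 2x)²`, merge the two copies), after the
exponent bookkeeping `(1/3 : ℚ) − 1 = −2/3` and `1 − 2·(1/3 : ℚ) = 1/3` in `ℝ`.

References: M. Kontsevich, D. Zagier, *Periods* (2001), §1.2 rules (1), (2).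
-/

noncomputable section

open MeasureTheory Set
open Literature.NumberTheory.Transcendental

namespace Summit.KontsevichZagierPeriods.InverseLandau

/-- **Stub `lowdimDuplicationOneThird`** (= item `LowdimDuplicationOneThird`,
stmt-KontsevichZagierPeriods-0118, of route LowDimension, verbatim): any representation
`[(0,1), (x(1−x))^{−2/3}]` is KZ-equivalent to any representation `[(0,1), 2^{1/3} x^{−1/2}(1−x)^{−2/3}]`
— the instance `a = 1/3` of `tateLifting_duplicationFamily` (Legendre duplication inside the rules).
[cite: KontsevichZagier2001, §1.2 rule (2)] -/
theorem tateLifting_lowdimDuplicationOneThird :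
    ∀ (r r' : KZ.IntegralRep 1), r.domain = {x | x 0 ∈ Set.Ioo (0:ℝ) 1} → Set.EqOn r.integrand (fun x => (x 0 * (1 - x 0)) ^ (-(2:ℝ)/3)) r.domain → r'.domain = {x | x 0 ∈ Set.Ioo (0:ℝ) 1} → Set.EqOn r'.integrand (fun x => (2:ℝ) ^ ((1:ℝ)/3) * (x 0) ^ (-(1:ℝ)/2) * (1 - x 0) ^ (-(2:ℝ)/3)) r'.domain → KZ.Equivalent r r' := by
  intro r r' hrd hri hr'd hr'i
  have e1 : ((1/3 : ℚ) : ℝ) - 1 = -(2:ℝ)/3 := by norm_num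
  have e2 : 1 - 2 * ((1/3 : ℚ) : ℝ) = (1:ℝ)/3 := by norm_num
  refine tateLifting_duplicationFamily (1/3) (by norm_num) r r' hrd (fun x hx => ?_) hr'd (fun x hx => ?_)
  · show r.integrand x = (x 0 * (1 - x 0)) ^ (((1/3 : ℚ) : ℝ) - 1)
    rw [e1]
    exact hri hx
  · show r'.integrand x =
      (2:ℝ) ^ (1 - 2 * ((1/3 : ℚ) : ℝ)) * (x 0) ^ (-(1:ℝ)/2) * (1 - x 0) ^ (((1/3 : ℚ) : ℝ) - 1)
    rw [e1, e2]
    exact hr'i hx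

end Summit.KontsevichZagierPeriods.InverseLandau

end
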